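import Mathlib
import Summits.Ventures.PercRepro2.GoodCoordinate

/-!
# At the root of the STEP(0,3) tree every coordinate is good
(seat mine-b, cell pub-perc-repro2; conjectures/MINE-B.md §15 Addendum 12)

For the pair `(B □ B, B)` — the unpinned i = 0 row STEP(0,3) of the clutter `B` — the doubly pivotal
configurations are contained in `E_i` for EVERY coordinate `i`: a configuration of `A₀ □ B₁` with
`A = B □ B` carries three pairwise disjoint `B`-witnesses `W₁, W₂, W₃` of which exactly `W₃` needs `i`, and
relabelling (`W₁ ∪ W₃` as the `A₁`-witness, `W₂` as the `B₀`-witness) shows that it is also a configuration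
of `A₁ □ B₀`. Hence `N_i ≤ E_i ≤ D_i + E_i`: the root of the tree always has a good coordinate
(`cN_le_cE_root`, `good_root`), and `Φ(insert i U'; B □ B, B) ≥ Φ(U'; B □ B, B₁) + Φ(U'; (B □ B)₁, B)` for
every `i` (`Phi_root_ge`). The same relabelling fails one level down (the first event becomes
`B □ B₁ ∨ B₁ □ B`, whose witnesses are not all `B`-witnesses), which is where (GC-STEP) begins.
-/

open Finset

namespace Summit.Ventures.PercRepro2

namespace StepZero

open ReimerCube

variable {E : Type*} [DecidableEq E]

open Classical

/-- **the doubly pivotal configurations of `(B □ B, B)` lie in `E_i`**: `N_i ≤ E_i` at the root, for every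
event `B` (monotonicity is not even needed), every cube `U'` and every coordinate `i ∉ U'`. -/
theorem cN_le_cE_root (U' : Finset E) (B : Finset E → Prop) {i : E} (hi : i ∉ U') :
    cN U' (DOcc B B) B i ≤ cE U' (DOcc B B) B i := by
  unfold cN cE
  apply Finset.card_le_card
  intro γ hγ
  rw [Finset.mem_filter] at hγ ⊢
  obtain ⟨hγU, hX, hnZ, -, hb0⟩ := hγ
  refine ⟨hγU, hX, ?_, hnZ, hb0⟩
  -- the witnesses of `A₀ □ B₁`: `K` carries two disjoint `B`-witnesses, `L ∪ i` is a `B`-witness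
  obtain ⟨K, L, hK, hL, hKL, hAK, hBL⟩ := hX
  obtain ⟨K₁, K₂, hK₁, hK₂, hK₁₂, hB₁, hB₂⟩ := hAK K le_rfl
  have hiγ : i ∉ γ := fun h => hi (Finset.mem_powerset.mp hγU h)
  -- `A₁ □ B₀` with the witnesses `K₁ ∪ L` (for `A₁ = (B □ B)(insert i ·)`) and `K₂` (for `B`)
  refine ⟨K₁ ∪ L, K₂, Finset.union_subset (hK₁.trans hK) hL, hK₂.trans hK, ?_, ?_, hB₂⟩
  · -- `K₁ ∪ L` and `K₂` are disjoint
    rw [Finset.disjoint_union_left]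
    exact ⟨hK₁₂, (Finset.disjoint_of_subset_left hK₂ hKL).symm⟩
  · -- every `T ⊇ K₁ ∪ L` has `B □ B` at `insert i T`: witnesses `K₁` and `insert i L`
    intro T hT
    have hK₁T : K₁ ⊆ T := (Finset.subset_union_left).trans hT
    have hLT : L ⊆ T := (Finset.subset_union_right).trans hT
    refine ⟨K₁, insert i L, hK₁T.trans (Finset.subset_insert i T),
      Finset.insert_subset_insert i hLT, ?_, hB₁, ?_⟩
    · -- `i ∉ K₁` since `K₁ ⊆ γ` and `i ∉ γ`
      rw [Finset.disjoint_insert_right]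
      exact ⟨fun h => hiγ (hK (hK₁ h)), (Finset.disjoint_of_subset_left hK₁ hKL)⟩
    · intro S hS
      have h1 : L ⊆ S := (Finset.subset_insert i L).trans hS
      have h2 : insert i S = S := Finset.insert_eq_of_mem (hS (Finset.mem_insert_self i L))
      have h3 : B (insert i S) := hBL S h1
      rwa [h2] at h3

/-- **every coordinate is good at the root `(B □ B, B)`** -/
theorem good_root (U' : Finset E) (B : Finset E → Prop) {i : E} (hi : i ∉ U') :
    cN U' (DOcc B B) B i ≤ cD U' (DOcc B B) B i + cE U' (DOcc B B) B i :=
  le_trans (cN_le_cE_root U' B hi) (Nat.le_add_left _ _)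

/-- at the root the two-term functional dominates the sum over the two cross pairs, for every `i` -/
theorem Phi_root_ge (U' : Finset E) {B : Finset E → Prop} (hB : Incr B) {i : E} (hi : i ∉ U') :
    Phi U' (DOcc B B) (sec1 i B) + Phi U' (sec1 i (DOcc B B)) B ≤ Phi (insert i U') (DOcc B B) B := by
  have hA : Incr (DOcc B B) := by
    intro S T hST h
    obtain ⟨K, L, hK, hL, hd, h1, h2⟩ := h
    exact ⟨K, L, hK.trans hST, hL.trans hST, hd, h1, h2⟩
  rw [Phi_insert U' hi hA hB]
  have h := good_root U' B hi
  have h' : (cN U' (DOcc B B) B i : ℤ) ≤ cD U' (DOcc B B) B i + cE U' (DOcc B B) B i := by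
    exact_mod_cast h
  linarith

end StepZero

end Summit.Ventures.PercRepro2
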